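import Summits.NavierStokesRegularity.NavierStokesRegularity.Theorems.RecurrentProfilesRecurrentLiouvillePrTwoSidedRecurrence
import Summits.NavierStokesRegularity.NavierStokesRegularity.Theorems.RecurrentProfilesRecurrentLiouvilleSmErgodicMeasure
import Summits.NavierStokesRegularity.NavierStokesRegularity.Theorems.RecurrentProfilesRecurrentLiouvilleSmGenericPoints
import Literature.Dynamics.TopologicalDynamics.MinimalOrbitClosure
import Mathlib.Topology.Metrizable.Uniformity
import Mathlib.Topology.MetricSpace.Basic
import Mathlib.Topology.ContinuousMap.Bounded.Basic
import Mathlib.MeasureTheory.Constructions.BorelSpace.Basic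
import Mathlib.MeasureTheory.Measure.HasOuterApproxClosed
import Mathlib.MeasureTheory.Measure.Typeclasses.Probability
import Mathlib.Dynamics.Ergodic.Ergodic
import Mathlib.Dynamics.BirkhoffSum.Average
import HarnessLib

/-!
# Crux `RecurrentLiouville` (stmt-NavierStokesRegularity-1589), line `Sketch` v10 — stub SM3:
# a GENERIC UNIFORMLY RECURRENT point in a compact invariant set of a pseudo-metrisable `ℝ`-flow

Theorems-only `--supports` helper (lead c12) for `stub_smGenericReduction`.  The abstract dynamics
of the generic recurrent reduction, separated from the Navier–Stokes bookkeeping: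

* `stub_smGenericRecurrentPoint` (registered stub of the skeleton) — let `ℝ` act on a
  PSEUDO-METRISABLE space `X` by continuous maps with the action law and `ϕ 0 = id`, and let `S` be
  a nonempty compact invariant set.  Then some `y ∈ S` is UNIFORMLY RECURRENT for the flow and
  GENERIC along the backward unit steps: the Cesàro averages `(1/N) ∑_{k<N} g (ϕ (−k) y)` converge
  for every bounded continuous observable `g`.  Proof: pass to the separation quotient `Y` of `S`
  (compact metric); take a minimal set `M` of the backward unit-step homeomorphism `T = ϕ(−1)`
  (orbit closure of a uniformly recurrent point, Furstenberg 1.16/1.17); put an ERGODIC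
  `T`-invariant Borel probability measure on `M` (SM1 `stub_smErgodicMeasure`) and take a GENERIC
  point of it (SM2 `stub_smGenericPoints`); every point of the minimal `M` is uniformly recurrent
  for the steps, hence for the flow (`stub_prTwoSidedRecurrence`, p160858); lift along the inducing
  quotient map (observables on a pseudo-metric space factor through the separation quotient).

## References

* M. Einsiedler, T. Ward, *Functional Analysis, Spectral Theory, and Applications*, GTM 276
  (2017), Prop. 8.36, Thm. 8.80. [EinsiedlerWard2017]
* M. Brin, G. Stuck, *Introduction to Dynamical Systems*, CUP (2002), Prop. 4.6.2, §4.7.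
* H. Furstenberg, *Recurrence in Ergodic Theory and Combinatorial Number Theory* (1981), Ch. 1 §4,
  Thms 1.15–1.17. [Furstenberg1981]
-/

noncomputable section

-- the sub-problem namespace repeats the summit name (D-0017 layout `Summit.<S>.<P>.Theorems`)
set_option linter.dupNamespace false

namespace Summit.NavierStokesRegularity.NavierStokesRegularity.Theorems

open MeasureTheory Set Function Filter Topology TopologicalSpace
open Literature.Dynamics.TopologicalDynamics
open scoped NNReal ENNReal BoundedContinuousFunction

/-! ### A generic uniformly recurrent point of a compact metrisable `ℕ`-system generated by a
homeomorphism -/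

/-- **Discrete core.**  On a nonempty compact metrisable space let `T`, `T'` be mutually inverse
continuous maps.  Then some point `y` is uniformly recurrent for the iterates of `T` AND generic:
for every bounded continuous `g` the Birkhoff averages `(1/n) ∑_{k<n} g (T^k y)` converge.
Proof: a minimal set `M` of `T` (orbit closure of a uniformly recurrent point), an ergodic
`T|_M`-invariant Borel probability measure on `M` (SM1), a generic point of it (SM2); every point of
the compact minimal `M` is uniformly recurrent. [folklore] -/
theorem smGR_exists_generic_recurrent_discrete {Y : Type*} [TopologicalSpace Y] [CompactSpace Y]
    [MetrizableSpace Y] [Nonempty Y] {T : Y → Y} (hT : Continuous T) :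
    ∃ y : Y, IsUniformlyRecurrentPt (fun (n : ℕ) (x : Y) => T^[n] x) y ∧
      ∀ g : Y →ᵇ ℝ, ∃ c : ℝ,
        Tendsto (fun N : ℕ => (N : ℝ)⁻¹ * ∑ k ∈ Finset.range N, g (T^[k] y)) atTop (𝓝 c) := by
  classical
  -- the `ℕ`-action of the iterates
  set ψ : ℕ → Y → Y := fun n x => T^[n] x with hψ
  have hcontψ : ∀ n, Continuous (ψ n) := fun n => hT.iterate n
  have haddψ : ∀ (m n : ℕ) (x : Y), ψ (m + n) x = ψ m (ψ n x) := fun m n x =>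
    Function.iterate_add_apply T m n x
  have hjψ : Continuous fun p : ℕ × Y => ψ p.1 p.2 := prTS_continuous_uncurry_nat hcontψ
  -- a uniformly recurrent point and its (minimal, compact) orbit closure `M`
  obtain ⟨y₁, -, hy₁⟩ := exists_isUniformlyRecurrentPt (ϕ := ψ) hcontψ haddψ isCompact_univ
    univ_nonempty (fun n => mapsTo_univ _ _)
  set M : Set Y := closure (range fun n : ℕ => ψ n y₁) with hM
  have hMc : IsCompact M := isClosed_closure.isCompact
  have hMinv : ∀ n, MapsTo (ψ n) M M := fun n => mapsTo_closure_orbit hcontψ haddψ n y₁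
  have hy₁M : y₁ ∈ M := subset_closure ⟨0, rfl⟩
  have hMrec : ∀ y ∈ M, IsUniformlyRecurrentPt ψ y := fun y hy =>
    hy₁.of_mem_closure_orbit_of_isCompact hjψ haddψ hMc hy
  have hTM : MapsTo T M M := by
    intro m hm
    have h := hMinv 1 hm
    simpa only [hψ, Function.iterate_one] using h
  -- the compact metrisable subsystem `(M, T|_M)` with its Borel structure
  haveI hMcs : CompactSpace M := isCompact_iff_compactSpace.1 hMc
  haveI : Nonempty M := ⟨⟨y₁, hy₁M⟩⟩
  letI : MeasurableSpace M := borel M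
  haveI : BorelSpace M := ⟨rfl⟩
  let TM : M → M := hTM.restrict T M M
  have hTMc : Continuous TM := hT.restrict hTM
  have hTMval : ∀ (k : ℕ) (x : M), ((TM^[k] x : M) : Y) = T^[k] (x : Y) := by
    intro k
    induction k with
    | zero => intro x; rfl
    | succ k ih =>
        intro x
        rw [Function.iterate_succ_apply', Function.iterate_succ_apply', ← ih]
        rfl
  -- an ergodic measure on `M` and a generic point of it
  obtain ⟨μ, hμ, herg⟩ := stub_smErgodicMeasure (X := M) hTMc
  haveI := hμ
  obtain ⟨x, hx⟩ := (stub_smGenericPoints (X := M) hTMc μ herg).exists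
  refine ⟨(x : Y), ?_, fun g => ?_⟩
  · -- uniform recurrence: every point of `M` is uniformly recurrent for `ψ`
    exact hMrec _ x.2
  · -- genericity, read through the restriction of `g` to `M`
    let gM : M →ᵇ ℝ := g.compContinuous ⟨Subtype.val, continuous_subtype_val⟩
    refine ⟨∫ z, gM z ∂μ, ?_⟩
    have h := hx gM
    refine h.congr fun N => ?_
    rw [birkhoffAverage, birkhoffSum, smul_eq_mul]
    congr 1
    refine Finset.sum_congr rfl fun k _ => ?_
    show g ((TM^[k] x : M) : Y) = g (T^[k] (x : Y))
    rw [hTMval]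

/-! ### The flow statement -/

/-- **SM3 · GENERIC UNIFORMLY RECURRENT POINTS OF COMPACT INVARIANT SETS.**  Let `ℝ` act on a
pseudo-metrisable space `X` by continuous maps with the action law and `ϕ 0 = id`, and let `S` be a
nonempty compact invariant set.  Then some `y ∈ S` is UNIFORMLY RECURRENT for the flow (return
times to every neighbourhood relatively dense in `ℝ`) and GENERIC along the backward unit steps:
for every bounded continuous observable `g : X →ᵇ ℝ` the Cesàro averages
`(1/N) ∑_{k<N} g (ϕ (−k) y)` converge.  Proof: separation quotient `Y` of `S` (compact metric),
the discrete core `smGR_exists_generic_recurrent_discrete` for the homeomorphism `T = ϕ(−1)` of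
`Y` (minimal set, ergodic measure SM1, generic point SM2), two-sidedness of uniform recurrence
(`stub_prTwoSidedRecurrence`), and the lift along the inducing map `SeparationQuotient.mk`
(a continuous observable on `S` is constant on inseparable pairs, so it factors through `Y`).
[folklore] -/
theorem stub_smGenericRecurrentPoint {X : Type*} [TopologicalSpace X] [PseudoMetrizableSpace X]
    {ϕ : ℝ → X → X} (hcont : ∀ t, Continuous (ϕ t))
    (hadd : ∀ s t x, ϕ (s + t) x = ϕ s (ϕ t x)) (h0 : ∀ x, ϕ 0 x = x)
    {S : Set X} (hS : IsCompact S) (hne : S.Nonempty) (hinv : ∀ t, MapsTo (ϕ t) S S) :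
    ∃ y ∈ S, IsUniformlyRecurrentPt ϕ y ∧
      ∀ g : X →ᵇ ℝ, ∃ c : ℝ,
        Tendsto (fun N : ℕ => (N : ℝ)⁻¹ * ∑ k ∈ Finset.range N, g (ϕ (-(k : ℝ)) y)) atTop (𝓝 c) := by
  classical
  -- ## the compact subsystem `S` and its Hausdorff (separation) quotient `Y`
  haveI hScs : CompactSpace S := isCompact_iff_compactSpace.1 hS
  haveI : Nonempty S := hne.to_subtype
  let ϕS : ℝ → S → S := fun t s => ⟨ϕ t s.1, hinv t s.2⟩
  have hcontS : ∀ t, Continuous (ϕS t) := fun t =>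
    ((hcont t).comp continuous_subtype_val).subtype_mk _
  have haddS : ∀ s t (x : S), ϕS (s + t) x = ϕS s (ϕS t x) := fun s t x =>
    Subtype.ext (hadd s t x.1)
  have h0S : ∀ x : S, ϕS 0 x = x := fun x => Subtype.ext (h0 x.1)
  letI mS : PseudoMetricSpace S := TopologicalSpace.pseudoMetrizableSpacePseudoMetric S
  let Y := SeparationQuotient S
  haveI hYc : CompactSpace Y := Quotient.compactSpace
  haveI : Nonempty Y := ⟨SeparationQuotient.mk (Classical.arbitrary S)⟩
  let ϕY : ℝ → Y → Y := fun t =>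
    SeparationQuotient.lift (SeparationQuotient.mk ∘ ϕS t)
      (fun a b h => SeparationQuotient.mk_eq_mk.2 (h.map (hcontS t)))
  have hϕY_mk : ∀ t (s : S), ϕY t (SeparationQuotient.mk s) = SeparationQuotient.mk (ϕS t s) :=
    fun t s => SeparationQuotient.lift_mk _ s
  have hcontY : ∀ t, Continuous (ϕY t) := fun t =>
    SeparationQuotient.continuous_lift_iff.2 (SeparationQuotient.continuous_mk.comp (hcontS t))
  have haddY : ∀ s t (q : Y), ϕY (s + t) q = ϕY s (ϕY t q) := by
    intro s t q
    obtain ⟨a, rfl⟩ := SeparationQuotient.surjective_mk q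
    rw [hϕY_mk, hϕY_mk, hϕY_mk, haddS]
  have h0Y : ∀ q : Y, ϕY 0 q = q := by
    intro q
    obtain ⟨a, rfl⟩ := SeparationQuotient.surjective_mk q
    rw [hϕY_mk, h0S]
  -- integer backward times are iterates of `T = ϕY (-1)`
  have hψ : ∀ (n : ℕ) (q : Y), ϕY (-(n : ℝ)) q = (ϕY (-1))^[n] q := by
    intro n
    induction n with
    | zero => intro q; rw [Nat.cast_zero, neg_zero, h0Y]; rfl
    | succ n ih =>
        intro q
        rw [Function.iterate_succ_apply', ← ih, ← haddY]
        congr 1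
        push_cast
        ring
  -- ## the discrete core on `Y`, and two-sidedness
  obtain ⟨yY, hrecψ, hgenY⟩ :=
    smGR_exists_generic_recurrent_discrete (Y := Y) (T := ϕY (-1)) (hcontY (-1))
  have hrecψ' : IsUniformlyRecurrentPt (fun (n : ℕ) (x : Y) => ϕY (-(n : ℝ)) x) yY := by
    have : (fun (n : ℕ) (x : Y) => ϕY (-(n : ℝ)) x) = fun n x => (ϕY (-1))^[n] x :=
      funext fun n => funext fun x => hψ n x
    rw [this]
    exact hrecψ
  have hrecY : IsUniformlyRecurrentPt ϕY yY :=
    stub_prTwoSidedRecurrence (X := Y) hcontY haddY h0Y hrecψ'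
  -- ## lift to `S`, transfer the recurrence to `S` (`mk` is inducing) and to `X`
  obtain ⟨y, rfl⟩ := SeparationQuotient.surjective_mk yY
  have hrecSy : IsUniformlyRecurrentPt ϕS y := by
    intro U hU
    rw [← SeparationQuotient.comap_mk_nhds_mk, mem_comap] at hU
    obtain ⟨V, hV, hVU⟩ := hU
    refine (hrecY V hV).mono fun t ht => hVU ?_
    show SeparationQuotient.mk (ϕS t y) ∈ V
    rw [← hϕY_mk]
    exact ht
  have hrecX : IsUniformlyRecurrentPt ϕ (y : X) := by
    intro U hU
    have hU' : Subtype.val ⁻¹' U ∈ 𝓝 y := continuous_subtype_val.continuousAt.preimage_mem_nhds hU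
    exact (hrecSy _ hU').mono fun t ht => ht
  refine ⟨y, y.2, hrecX, fun g => ?_⟩
  -- ## genericity: observables factor through the separation quotient
  let gS : S →ᵇ ℝ := g.compContinuous ⟨Subtype.val, continuous_subtype_val⟩
  have hgS_insep : ∀ a b : S, Inseparable a b → gS a = gS b := fun a b h =>
    (h.map gS.continuous).eq
  let gY₀ : C(Y, ℝ) :=
    ⟨SeparationQuotient.lift gS hgS_insep,
      SeparationQuotient.continuous_lift_iff.2 gS.continuous⟩
  let gY : Y →ᵇ ℝ := BoundedContinuousFunction.mkOfCompact gY₀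
  have hgY_mk : ∀ s : S, gY (SeparationQuotient.mk s) = g (s : X) := fun s =>
    SeparationQuotient.lift_mk hgS_insep s
  obtain ⟨c, hc⟩ := hgenY gY
  refine ⟨c, hc.congr fun N => ?_⟩
  congr 1
  refine Finset.sum_congr rfl fun k _ => ?_
  rw [← hψ, hϕY_mk, hgY_mk]

end Summit.NavierStokesRegularity.NavierStokesRegularity.Theorems

end
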